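import Mathlib.FieldTheory.IsAlgClosed.AlgebraicClosure
import Mathlib.NumberTheory.NumberField.Basic
import Literature.NumberTheory.GaloisRepresentations.DiscreteValuationDivisibleUnits
import Literature.AnabelianGeometry.AbsoluteAnabelian.AbsTopIII.KummerFaithful
import HarnessLib

/-!
# [AbsTopIII] Remark 1.5.3 (i) — the PRINTED general form (infinite algebraic extensions)

Proof-only companion of `AbsTopIII/KummerFaithful.lean` (statement owner abc-iut-L4-t1; never
edited here; this file and its two engine files: seat abc-iut-L4-t16, row «RMK153i-GENERAL») and
sequel of `AbsTopIII/KummerFaithfulProofs.lean` (`Rmk_1_5_3_i_holds`, the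
number-field special case, via Dirichlet's unit theorem).  S. Mochizuki, *Topics in Absolute
Anabelian Geometry III*, Remark 1.5.3 (i), kurims manuscript p. 33 (lit key
`paper:url-5493eb38cbb7`, read on the page) [cite: MochizukiAbsTopIII2015, Rmk 1.5.3 (i) p.33]:

> "(i) Let `k` be a(n) [not necessarily finite!] algebraic field extension of a number field such
> that there exists a nonarchimedean prime of `k` that is unramified over some number field
> contained in `k`, and, moreover, for every finite extension `k†` of `k`, `μ(k†)` is finite.
> Then I claim that: `k` is torally Kummer-faithful.  Indeed, since [...] any finite extension of
> `k` satisfies the same hypotheses as `k`, one verifies immediately that it suffices to show that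
> `⋂_N (k^×)^N = {1}` [...].  Let `f ∈ ⋂_N (k^×)^N`.  If `f ∈ μ(k)`, then the assumption
> concerning `μ(k)` implies immediately that `f = 1`; thus, we may assume without loss of
> generality that `f ∉ μ(k)`.  But then there exists a nonarchimedean prime `𝔭` of `k` that is
> unramified over some number field contained in `k`.  In particular, if we write `k_𝔭` for the
> completion of `k` at `𝔭` and `p` for the residue characteristic of `𝔭`, then `k_𝔭` embeds into
> a finite extension of the quotient field of the ring of Witt vectors of an algebraic closure of
> `𝔽_p`.  Thus, the fact that `f` admits arbitrary `p`-power roots in `k_𝔭` yields a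
> contradiction."

The statement file records only the number-field special case (`Rmk_1_5_3_i`, carrying
`-- TODO(general form): infinite algebraic extensions of number fields as printed`); this file
PROVES the printed general form: `isTorallyKummerFaithful_of_unramified_prime`.

## How the printed hypotheses are typed (one-closure model)

All algebraic extensions of the number field `F` live inside `Ω := AlgebraicClosure F`:
* "`k` a(n) algebraic field extension of a number field": `k : IntermediateField F Ω`;
* "a nonarchimedean prime `𝔭` of `k`": a nontrivial valuation ring `A ≠ ⊤` of `Ω`, with
  valuation `v := A.valuation` (its trace on `k` is the prime; conversely every prime of `k`
  extends to `Ω` by Chevalley's extension theorem — not in Mathlib, which is why the prime is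
  carried on `Ω`; its residue characteristic is `p`, `v(p) < 1`);
* "unramified over some number field `K₁` contained in `k`": `K₁ : IntermediateField F Ω`, finite
  over `F`, with `v(k^×) ⊆ v(K₁^×)` (`hunr`).  For an INFINITE algebraic extension, "`𝔭`
  unramified over `K₁`" means ramification index `1` at every finite layer `K₁ ⊆ K₂ ⊆ k`, i.e.
  the value group of `k` at `𝔭` equals that of `K₁`; the containment `K₁ ⊆ k` itself is not used
  by the argument and therefore not assumed (the theorem is the stronger for it);
* "for every finite extension `k†` of `k`, `μ(k†)` is finite": `hμ`, over all fields `k†` finite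
  over `k` (`CommGroup.torsion k†ˣ` finite);
* conclusion: `IsTorallyKummerFaithful k` as typed in the statement file (`char k = 0` and
  `⋂_N (k'^×)^N = {1}` for every finite extension `k'/k`).

## Proof (print's `p`-adic route made elementary; engine in
`Literature/NumberTheory/GaloisRepresentations/{ValuationPadicDiscreteness,
DiscreteValuationDivisibleUnits}.lean`)

Completion and Witt vectors are avoided: what the printed contradiction uses about `k_𝔭` is
(a) DISCRETENESS of the valuation — this is where "unramified over a number field" enters: the
value group of `k` is that of the number field `K₁`, which is `p`-adically discrete because
`K₁/ℚ` is finite (`v(y)^{[K₁:ℚ]!} ∈ v(p)^ℤ`, ultrametric degree bound + Bezout on `ℚ`);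
(b) the residue field is algebraic over `𝔽_p`, so the residue class of a unit has finite order;
(c) `p`-power roots of a principal unit are principal units (Frobenius injectivity), on which
`u ↦ u^p` contracts: `v(u^p − 1) ≤ v(u − 1) · max(v(p), v(u − 1))`.  A finite extension `k'` of
`k` is embedded into `Ω` over `k` (`IsAlgClosed.lift`) and given the restricted valuation
`v' := v ∘ ψ`; (a) persists with exponent `[k':k]! · [K₁:ℚ]!` by the degree bound, (b) holds on
all of `Ω`, and `μ(k')` is finite by hypothesis — so the engine
`units_eq_one_of_forall_exists_pow_eq_of_valuation` applies to `k'`.  Classical; Mathlib-only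
apart from the Literature imports; no new definitions, no named facts; nothing here takes a side
on any claim beyond Remark 1.5.3 (i) itself.
-/

noncomputable section

open scoped Classical

namespace Literature.AnabelianGeometry.AbsoluteAnabelian.AbsTopIII

open Literature.NumberTheory.GaloisRepresentations

variable {F : Type} [Field F] [NumberField F]

/-- **[AbsTopIII] Remark 1.5.3 (i), printed general form.**  Let `k ⊆ Ω = F̄` be any algebraic
extension of the number field `F`, `A ≠ ⊤` a nontrivial valuation ring of `Ω` ("a nonarchimedean
prime `𝔭` of `k`", extended to `Ω`), `K₁ ⊆ Ω` a number field (finite over `F`) with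
`A.valuation(k^×) ⊆ A.valuation(K₁^×)` ("`𝔭` is unramified over some number field": the value
group of `k` at `𝔭` is that of `K₁`), and suppose `μ(k†)` is finite for every finite extension
`k†` of `k`.  Then `k` is torally Kummer-faithful: `⋂_N (k'^×)^N = {1}` for every finite
extension `k'/k`.  (The special case `k` a number field is `Rmk_1_5_3_i_holds`; print's
"contained in `k`" for `K₁` is not needed and not assumed.)
[cite: MochizukiAbsTopIII2015, Rmk 1.5.3 (i) p.33] -/
theorem isTorallyKummerFaithful_of_unramified_prime
    (k : IntermediateField F (AlgebraicClosure F))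
    (A : ValuationSubring (AlgebraicClosure F)) (hA : A ≠ ⊤)
    (K₁ : IntermediateField F (AlgebraicClosure F)) [FiniteDimensional F K₁]
    (hunr : ∀ x ∈ k, x ≠ 0 → ∃ y ∈ K₁, A.valuation x = A.valuation y)
    (hμ : ∀ (k' : Type) [Field k'] [Algebra k k'], Module.Finite k k' →
      Finite (CommGroup.torsion k'ˣ)) :
    IsTorallyKummerFaithful k := by
  set v := A.valuation with hv
  haveI : CharZero (AlgebraicClosure F) :=
    charZero_of_injective_algebraMap (algebraMap F (AlgebraicClosure F)).injective
  -- (0) nontriviality: some element of `Ω` has valuation `> 1`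
  have hnt : ∃ x : AlgebraicClosure F, 1 < v x := by
    by_contra h
    push Not at h
    exact hA (eq_top_iff.mpr fun x _ => (A.valuation_le_one_iff x).mp (h x))
  -- (1) the residue characteristic `p` of `𝔭`
  haveI : Algebra.IsAlgebraic ℚ (AlgebraicClosure F) :=
    Algebra.IsAlgebraic.trans ℚ F (AlgebraicClosure F)
  obtain ⟨p, hp, hvp⟩ := exists_prime_valuation_lt_one v hnt
  haveI : Fact p.Prime := ⟨hp⟩
  -- (2) weak discreteness of the number field `K₁`, exponent `[K₁:ℚ]!`
  haveI : FiniteDimensional ℚ K₁ := Module.Finite.trans F K₁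
  have hQ : ∀ c : ℚ, c ≠ 0 → ∃ n : ℤ,
      (v.comap (algebraMap K₁ (AlgebraicClosure F))) (algebraMap ℚ K₁ c) ^ 1
        = v (p : AlgebraicClosure F) ^ n := by
    intro c hc
    obtain ⟨n, hn⟩ := exists_valuation_ratCast_eq_zpow v hp hvp hc
    refine ⟨n, ?_⟩
    rw [pow_one, Valuation.comap_apply, eq_ratCast, map_ratCast]
    exact hn
  have hK₁ : ∀ y : K₁, y ≠ 0 → ∃ n : ℤ,
      (v.comap (algebraMap K₁ (AlgebraicClosure F))) y ^ (Module.finrank ℚ K₁).factorial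
        = v (p : AlgebraicClosure F) ^ n := by
    intro y hy
    have h := exists_valuation_pow_mul_eq_zpow_of_finiteDimensional (K := ℚ)
      (v.comap (algebraMap K₁ (AlgebraicClosure F))) hQ hy
    simpa only [mul_one] using h
  -- (3) the torus clause, for a finite extension `k'` of `k` embedded into `Ω` over `k`
  refine ⟨charZero_of_injective_algebraMap (algebraMap F k).injective,
    fun k' _ _ hfin => ⟨fun f hf => ?_⟩⟩
  haveI : Module.Finite k k' := hfin
  haveI : Algebra.IsAlgebraic k k' := Algebra.IsAlgebraic.of_finite k k'
  let ψ : k' →ₐ[k] AlgebraicClosure F := IsAlgClosed.lift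
  let v' : Valuation k' A.ValueGroup := v.comap (ψ : k' →+* AlgebraicClosure F)
  have hv' : ∀ x : k', v' x = v (ψ x) := fun x => rfl
  haveI : CharZero k' := charZero_of_injective_algebraMap (algebraMap k k').injective
  haveI : Finite (CommGroup.torsion k'ˣ) := hμ k' hfin
  have hvp' : v' (p : k') < 1 := by rw [hv', map_natCast ψ]; exact hvp
  have hp0' : (p : k') ≠ 0 := Nat.cast_ne_zero.mpr hp.ne_zero
  -- (3a) weak discreteness of `k'`, exponent `[k':k]! · [K₁:ℚ]!` — uses `hunr`
  have hk : ∀ c : k, c ≠ 0 → ∃ n : ℤ,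
      v' (algebraMap k k' c) ^ (Module.finrank ℚ K₁).factorial
        = v (p : AlgebraicClosure F) ^ n := by
    intro c hc
    have h1 : v' (algebraMap k k' c) = v (c : AlgebraicClosure F) := by
      rw [hv', AlgHom.commutes]
      rfl
    have hc' : (c : AlgebraicClosure F) ≠ 0 := by
      rw [Ne, ZeroMemClass.coe_eq_zero]
      exact hc
    obtain ⟨y, hyK₁, hy⟩ := hunr c c.2 hc'
    have hy0 : (⟨y, hyK₁⟩ : K₁) ≠ 0 := by
      intro h
      have hy' : y = 0 := congrArg Subtype.val h
      rw [hy', map_zero] at hy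
      exact ((Valuation.ne_zero_iff v).mpr hc') hy
    obtain ⟨n, hn⟩ := hK₁ ⟨y, hyK₁⟩ hy0
    refine ⟨n, ?_⟩
    rw [h1, hy]
    exact hn
  have hdisc : ∀ x : k', x ≠ 0 → ∃ n : ℤ,
      v' x ^ ((Module.finrank k k').factorial * (Module.finrank ℚ K₁).factorial)
        = v' (p : k') ^ n := by
    intro x hx
    obtain ⟨n, hn⟩ := exists_valuation_pow_mul_eq_zpow_of_finiteDimensional (K := k) v' hk hx
    refine ⟨n, ?_⟩
    rw [hn, hv', map_natCast ψ]
  -- (3b) unit residues of `k'` have finite order — holds on all of `Ω`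
  have hres : ∀ u : k', v' u = 1 → ∃ m : ℕ, 0 < m ∧ v' (u ^ m - 1) < 1 := by
    intro u hu
    have halg : IsAlgebraic ℤ (ψ u) :=
      (IsFractionRing.isAlgebraic_iff ℤ ℚ (AlgebraicClosure F)).mpr
        (Algebra.IsAlgebraic.isAlgebraic _)
    obtain ⟨m, hm, hlt⟩ :=
      exists_pos_valuation_pow_sub_one_lt_one v hvp (u := ψ u) (by rw [← hv']; exact hu) halg
    refine ⟨m, hm, ?_⟩
    rw [hv', map_sub, map_pow, map_one]
    exact hlt
  -- (3c) the engine
  exact units_eq_one_of_forall_exists_pow_eq_of_valuation v' hvp' hp0'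
    (Nat.mul_pos (Nat.factorial_pos _) (Nat.factorial_pos _)) hdisc hres f hf

end Literature.AnabelianGeometry.AbsoluteAnabelian.AbsTopIII
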